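import Summits.QuantumFields.YangMills.Theorems.SoloBlindSinglePlaquette
import HarnessLib

/-!
# The elementary Wilson loop at weak coupling (soloist rung D6″)

Solo seat `solo-QuantumFields-blind`, new mathematics for the conjunct `YangMills` of
`Summit.QuantumFields`.

The `1 × 1` Wilson loop is the plaquette: `W_{1×1}(U) = (1/N) Re tr ρ(U_{x,ij})`
(`wilsonLoop_one_one`; the identity `rectangleHolonomy U x i j 1 1 = plaquetteHolonomy U x i j` is
inlined). Hence, from the single-plaquette theorem
`weakCoupling_singlePlaquette` (`β ⟨N - Re tr ρ(U_p)⟩ → N²/d`):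

* `weakCoupling_plaquetteLoop` — for `d ≥ 2`, `N ≥ 1` and every unitary model (`G ≅ U(N)`):
  `∀ ε > 0, ∀ᶠ β → ∞, ∀ᶠ L → ∞, ∀ x, ∀ i ≠ j, |β (1 - ⟨W_{1×1}(x;i,j)⟩_{Λ_{L+1},β}) - N/d| ≤ ε`,
  the leading weak-coupling behaviour `⟨W_□⟩ = 1 - N/(dβ) + o(1/β)` of the elementary Wilson loop
  of `U(N)` lattice gauge theory with the Wilson action `S = ∑_p Re tr(1 - U_p)`, uniformly in the
  (large) volume — obtained without any expansion: free energy (Chatterjee) + convexity + lattice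
  symmetry, all kernel-checked.

References: S. Chatterjee, *The leading term of the Yang–Mills free energy*, J. Funct. Anal. 271
(2016) 2944–3005, arXiv:1602.01222, Thm. 2.1; S. Chatterjee, *Yang–Mills for probabilists*,
arXiv:1803.01950, §4 (Wilson loops). [folklore]
-/

open MeasureTheory Filter Topology
open Literature.MathematicalPhysics.QuantumFieldTheory Literature.RepresentationTheory.CompactGroups

noncomputable section

namespace Summit.QuantumFields.YangMills.Theorems.SoloBlind

section Loop

variable {d L N : ℕ} {G : Type*} [Group G] [TopologicalSpace G] [IsTopologicalGroup G]
  [CompactSpace G] [MeasurableSpace G] [BorelSpace G] (ρ : G →* Matrix (Fin N) (Fin N) ℂ)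

omit [TopologicalSpace G] [IsTopologicalGroup G] [CompactSpace G] [MeasurableSpace G]
  [BorelSpace G] in
/-- `W_{1×1} = (1/N)(N - φ)`: the `1 × 1` rectangle is the plaquette. [folklore] -/
theorem wilsonLoop_one_one (U : GaugeConfig d L G) (x : Site d L) (i j : Fin d) :
    wilsonLoop ρ x i j 1 1 U = (N : ℝ)⁻¹ * ((N : ℝ) - plaquetteCost ρ x i j U) := by
  have h : rectangleHolonomy U x i j 1 1 = plaquetteHolonomy U x i j := by
    simp only [rectangleHolonomy, lineHolonomy, plaquetteHolonomy, Site.shift, Nat.cast_one, mul_one]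
  simp only [wilsonLoop, h, plaquetteCost, sub_sub_cancel]

omit [CompactSpace G] in
/-- The cost of the plaquette at `x` in directions `(i, j)` (any order) is measurable. [folklore] -/
theorem measurable_plaquetteCost' (hρ : Continuous ρ) (x : Site d L) (i j : Fin d) :
    Measurable (plaquetteCost (G := G) ρ x i j) := by
  unfold plaquetteCost plaquetteHolonomy
  exact measurable_const.sub
    ((((WilsonRP.entryMeasurable_apply hρ _).mul (WilsonRP.entryMeasurable_apply hρ _)).mul
      (WilsonRP.entryMeasurable_apply_inv hρ _)).mul
        (WilsonRP.entryMeasurable_apply_inv hρ _)).measurable_trace_re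

/-- … and integrable for the torus Wilson state. [folklore] -/
theorem integrable_plaquetteCost' [NeZero L] (hρ : Continuous ρ) (β : ℝ) (x : Site d L)
    (i j : Fin d) : Integrable (plaquetteCost (G := G) ρ x i j) (wilsonMeasure ρ β) := by
  haveI := isProbabilityMeasure_wilsonMeasure (d := d) (L := L) ρ hρ β
  exact Integrable.of_bound (measurable_plaquetteCost' ρ hρ x i j).aestronglyMeasurable (2 * N)
    (ae_of_all _ fun U => by rw [Real.norm_eq_abs]; exact abs_plaquetteCost_le ρ hρ _ _ _ U)

/-- `⟨W_{1×1}⟩ = (1/N)(N - ⟨φ⟩)`. [folklore] -/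
theorem wilsonExpectation_wilsonLoop_one_one [NeZero L] (hρ : Continuous ρ) (β : ℝ) (x : Site d L)
    (i j : Fin d) :
    wilsonExpectation ρ β (wilsonLoop ρ x i j 1 1) =
      (N : ℝ)⁻¹ * ((N : ℝ) - wilsonExpectation ρ β (plaquetteCost ρ x i j)) := by
  haveI := isProbabilityMeasure_wilsonMeasure (d := d) (L := L) ρ hρ β
  simp only [wilsonExpectation, wilsonLoop_one_one]
  rw [integral_const_mul, integral_sub (integrable_const _) (integrable_plaquetteCost' ρ hρ β x i j)]
  simp [integral_const]

end Loop

variable {d N : ℕ} {G : Type} [Group G] [TopologicalSpace G] [IsTopologicalGroup G]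
  [CompactSpace G] [MeasurableSpace G] [BorelSpace G]

/-- **The elementary Wilson loop at weak coupling.** For `d ≥ 2`, `N ≥ 1` and every unitary model:
for every `ε > 0`, for all large `β` and then all large tori, for every base point and every ordered
pair of distinct directions, `|β (1 - ⟨W_{1×1}⟩_{Λ_{L+1},β}) - N/d| ≤ ε`. [cite: arXiv160201222, Thm. 2.1] -/
theorem weakCoupling_plaquetteLoop (ρ : G →* Matrix (Fin N) (Fin N) ℂ) (hd : 2 ≤ d) (hN : 1 ≤ N)
    (hρ : IsUnitaryModel ρ) :
    ∀ ε > 0, ∀ᶠ β : ℝ in atTop, ∀ᶠ L : ℕ in atTop, ∀ (x : Site d (L + 1)) (i j : Fin d), i ≠ j →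
      |β * (1 - wilsonExpectation ρ β (wilsonLoop ρ x i j 1 1)) - (N : ℝ) / d| ≤ ε := by
  intro ε hε
  have hρc : Continuous ρ := hρ.1
  have hN0 : (0 : ℝ) < N := by exact_mod_cast hN
  filter_upwards [weakCoupling_singlePlaquette ρ hd hN hρ (ε * N) (by positivity)] with β hβ
  filter_upwards [hβ] with L hL x i j hij
  have h := hL x i j hij
  rw [wilsonExpectation_wilsonLoop_one_one ρ hρc]
  set E : ℝ := wilsonExpectation ρ β (plaquetteCost ρ x i j)
  have hN1 : (N : ℝ) ≠ 0 := hN0.ne'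
  have : β * (1 - (N : ℝ)⁻¹ * ((N : ℝ) - E)) - (N : ℝ) / d = (β * E - (N : ℝ) ^ 2 / d) / N := by
    field_simp
    ring
  rw [this, abs_div, abs_of_pos hN0, div_le_iff₀ hN0]
  exact h

end Summit.QuantumFields.YangMills.Theorems.SoloBlind
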